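import Literature.AlgebraicGeometry.Resolution.HenselizedFunctionFieldsImmediate
import Literature.AlgebraicGeometry.Resolution.GeneralizedStabilityFiniteRankLemmas
import Literature.AlgebraicGeometry.Resolution.TameTowerRebase
import Mathlib.FieldTheory.SeparableClosure
import HarnessLib

/-!
# The inertia group of a finite Galois extension with stable valuation ring, I: residue maps

Topic: `Literature/AlgebraicGeometry/Resolution` (valued function fields). PROVED finite
ramification theory replacing the absolute ramification field `F^r` in the reduction step of
F.-V. Kuhlmann, *Elimination of ramification I*, Trans. AMS 362 (2010) = arXiv:1003.5678, §5,
proof of (R4), pp. 18–19 ("there is already a finite subextension `N|F` of `F^r|F` such that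
`E.N|N` is such a tower"; Lemma 2.27: "`(E|F,v)` is unramified"), for the named fact
`Kuhlmann2010TameTowerReduction` (`HenselizedFunctionFields.lean`); continued in
`TameTowerInertiaUnramified.lean`.

Setting: an ambient valued field `(Ω, V)`, a subfield `F ≤ Ω` and a finite extension `L` of
`F` inside `Ω` (an intermediate field of `Ω|F`) such that `V` is STABLE under `Gal(L|F)`:
`x ∈ V ↔ σ x ∈ V` for `x ∈ L` (this holds when `(F, V ∩ F)` is henselian, `V ∩ L` being
the unique extension of `V ∩ F`). The INERTIA condition on `σ ∈ Gal(L|F)` is `v(σ x - x) > 0`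
for all `x ∈ L ∩ V` (`σ` acts trivially on the residue field `Lv ⊆ Ωv`); these `σ` form the
inertia group `I` (`exists_inertia_subgroup`).

* `valuation_lt_one_iff_of_stable`, `valuation_sub_lt_one_of_stable` — the maximal ideal of `V`
  is stable as well.
* `exists_inertia_subgroup` — the inertia condition defines a subgroup.
* `exists_residueAlgHom` — `σ ∈ Gal(L|F)` induces an `Fv`-algebra map `Lv → Ωv` on residues.
* `index_inertia_le_finrank_separableClosure` — **`[G : I] ≤ [(Lv)_s : Fv]`**, `(Lv)_s` the
  separable closure of `Fv` in `Lv`: `G/I` embeds into the `Fv`-algebra maps `Lv → Ωv`, whose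
  number is the separable degree (`Ωv` is algebraically closed when `Ω` is).

No new definitions: subgroups and maps are packaged as existence statements.

## Sources

* Classical ramification theory of valued fields: O. Endler, *Valuation theory* (1972),
  §19–20; Kuhlmann 2010, §1.1 (decomposition/inertia/ramification fields of `K^sep|K`).
  [folklore]
-/

noncomputable section

open Module IntermediateField IsLocalRing

namespace Literature.AlgebraicGeometry.Resolution

universe u

variable {Ω : Type u} [Field Ω] (V : ValuationSubring Ω)

/-! ### Residues and the stability of `V` under `Gal(L|F)` -/

/-- Two elements of `V` have the same residue iff their difference has value `< 1`. [folklore] -/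
theorem residue_mk_eq_iff {a b : Ω} (ha : a ∈ V) (hb : b ∈ V) :
    residue V ⟨a, ha⟩ = residue V ⟨b, hb⟩ ↔ V.valuation (a - b) < 1 := by
  rw [← sub_eq_zero, ← map_sub, residue_eq_zero_iff, ValuationSubring.valuation_lt_one_iff]
  rfl

/-- For a non-zero `y`, `v(y) < 1` iff `y⁻¹ ∉ V`. [folklore] -/
theorem valuation_lt_one_iff_inv_not_mem {y : Ω} (hy : y ≠ 0) :
    V.valuation y < 1 ↔ y⁻¹ ∉ V := by
  rw [← not_le, Valuation.one_le_val_iff _ hy, ValuationSubring.valuation_le_one_iff]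

variable {V}
variable {F : Subfield Ω} {L : IntermediateField F Ω}

/-- If `V` is stable under `σ ∈ Gal(L|F)` then so is its maximal ideal:
`v(x) < 1 ↔ v(σ x) < 1` for `x ∈ L`. [folklore] -/
theorem valuation_lt_one_iff_of_stable
    (hV : ∀ (σ : L ≃ₐ[F] L) (x : L), (x : Ω) ∈ V ↔ ((σ x : L) : Ω) ∈ V)
    (σ : L ≃ₐ[F] L) (x : L) :
    V.valuation (x : Ω) < 1 ↔ V.valuation ((σ x : L) : Ω) < 1 := by
  by_cases hx : x = 0
  · simp [hx]
  · have hx' : (x : Ω) ≠ 0 := fun h => hx (by exact_mod_cast h)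
    have hσx : σ x ≠ 0 := (map_ne_zero σ).mpr hx
    have hσx' : ((σ x : L) : Ω) ≠ 0 := fun h => hσx (by exact_mod_cast h)
    rw [valuation_lt_one_iff_inv_not_mem V hx', valuation_lt_one_iff_inv_not_mem V hσx']
    have h := hV σ x⁻¹
    rw [map_inv₀] at h
    push_cast at h
    exact not_congr h

/-- Stability transports congruences modulo the maximal ideal:
`v(x - y) < 1 → v(σ x - σ y) < 1`. [folklore] -/
theorem valuation_sub_lt_one_of_stable
    (hV : ∀ (σ : L ≃ₐ[F] L) (x : L), (x : Ω) ∈ V ↔ ((σ x : L) : Ω) ∈ V)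
    (σ : L ≃ₐ[F] L) {x y : L} (h : V.valuation ((x : Ω) - y) < 1) :
    V.valuation (((σ x : L) : Ω) - (σ y : L)) < 1 := by
  have h1 := (valuation_lt_one_iff_of_stable hV σ (x - y)).mp (by push_cast; exact h)
  rw [map_sub] at h1
  push_cast at h1
  exact h1

/-- **The inertia group**: the automorphisms `σ ∈ Gal(L|F)` with `v(σ x - x) > 0` for all
`x ∈ L ∩ V` (i.e. acting trivially on the residue field of `L`) form a subgroup (when `V` is
stable under `Gal(L|F)`). Stated as an existence to avoid a definition: only membership is used.
[cite: Kuhlmann2010, Section 1.1] -/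
theorem exists_inertia_subgroup
    (hV : ∀ (σ : L ≃ₐ[F] L) (x : L), (x : Ω) ∈ V ↔ ((σ x : L) : Ω) ∈ V) :
    ∃ I : Subgroup (L ≃ₐ[F] L), ∀ σ, σ ∈ I ↔
      ∀ x : L, (x : Ω) ∈ V → V.valuation (((σ x : L) : Ω) - x) < 1 := by
  refine ⟨{ carrier :=
              {σ | ∀ x : L, (x : Ω) ∈ V → V.valuation (((σ x : L) : Ω) - x) < 1}
            one_mem' := fun x _ => by simp
            mul_mem' := ?_
            inv_mem' := ?_ }, fun σ => Iff.rfl⟩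
  · intro σ τ hσ hτ x hx
    have hτx : ((τ x : L) : Ω) ∈ V := (hV τ x).mp hx
    have h1 : V.valuation (((σ (τ x) : L) : Ω) - (τ x : L)) < 1 := hσ (τ x) hτx
    have h2 : V.valuation (((τ x : L) : Ω) - x) < 1 := hτ x hx
    have h3 := Valuation.map_add_lt V.valuation h1 h2
    rw [sub_add_sub_cancel] at h3
    exact h3
  · intro σ hσ x hx
    have hσx : ((σ⁻¹ x : L) : Ω) ∈ V := (hV σ⁻¹ x).mp hx
    have h1 : V.valuation (((σ (σ⁻¹ x) : L) : Ω) - (σ⁻¹ x : L)) < 1 :=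
      hσ (σ⁻¹ x) hσx
    rw [show σ (σ⁻¹ x) = x from AlgEquiv.apply_symm_apply σ x] at h1
    rw [← Valuation.map_neg, neg_sub]
    exact h1

/-! ### The residue fields `Fv ≤ Lv ≤ Ωv` -/

variable (V L)

/-- `Fv ≤ Lv` inside `Ωv`. [folklore] -/
theorem residueSubfield_base_le : residueSubfield F V ≤ residueSubfield L V :=
  residueSubfield_le_of_range_subset V (by
    rintro _ ⟨c, rfl⟩
    exact ⟨algebraMap F L c, rfl⟩)

variable {L}

/-- Membership in `Lv`: the residues of the elements of `L ∩ V`. [folklore] -/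
theorem mem_residueSubfield_intermediateField_iff (r : ResidueField V) :
    r ∈ residueSubfield L V ↔ ∃ (x : L) (hx : (x : Ω) ∈ V), residue V ⟨x, hx⟩ = r :=
  mem_residueSubfield_iff L V r

/-- The residue of `x ∈ L ∩ V` lies in `Lv`. [folklore] -/
theorem residue_mem_residueSubfield_intermediateField (x : L) (hx : (x : Ω) ∈ V) :
    residue V ⟨x, hx⟩ ∈ Subfield.extendScalars (residueSubfield_base_le V L) :=
  (mem_residueSubfield_intermediateField_iff V _).mpr ⟨x, hx, rfl⟩

/-- Membership in `Fv`: the residues of the elements of `F ∩ V`. [folklore] -/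
theorem mem_residueSubfield_subfield_iff (r : ResidueField V) :
    r ∈ residueSubfield F V ↔ ∃ (c : F) (hc : (c : Ω) ∈ V), residue V ⟨c, hc⟩ = r :=
  mem_residueSubfield_iff F V r

variable {V}

/-- **The residue map of `σ ∈ Gal(L|F)`**: a `Fv`-algebra homomorphism `Lv → Ωv` sending the
residue of `x ∈ L ∩ V` to the residue of `σ x` (well defined because `V` and its maximal ideal
are stable under `σ`). Stated as an existence to avoid a definition.
[cite: Kuhlmann2010, Section 1.1] -/
theorem exists_residueAlgHom
    (hV : ∀ (σ : L ≃ₐ[F] L) (x : L), (x : Ω) ∈ V ↔ ((σ x : L) : Ω) ∈ V)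
    (σ : L ≃ₐ[F] L) :
    ∃ ψ : Subfield.extendScalars (residueSubfield_base_le V L) →ₐ[residueSubfield F V]
        ResidueField V,
      ∀ (x : L) (hx : (x : Ω) ∈ V),
        ψ ⟨residue V ⟨x, hx⟩, residue_mem_residueSubfield_intermediateField V x hx⟩ =
          residue V ⟨(σ x : L), (hV σ x).mp hx⟩ := by
  classical
  -- choice of representatives
  have hrep : ∀ r : Subfield.extendScalars (residueSubfield_base_le V L),
      ∃ (x : L) (hx : (x : Ω) ∈ V), residue V ⟨x, hx⟩ = r := fun r =>
    (mem_residueSubfield_intermediateField_iff V (r : ResidueField V)).mp r.2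
  choose rep hrep_mem hrep_eq using hrep
  let f : Subfield.extendScalars (residueSubfield_base_le V L) → ResidueField V := fun r =>
    residue V ⟨(σ (rep r) : L), (hV σ (rep r)).mp (hrep_mem r)⟩
  -- `f` on residues
  have hf : ∀ (x : L) (hx : (x : Ω) ∈ V),
      f ⟨residue V ⟨x, hx⟩, residue_mem_residueSubfield_intermediateField V x hx⟩ =
        residue V ⟨(σ x : L), (hV σ x).mp hx⟩ := by
    intro x hx
    set r : Subfield.extendScalars (residueSubfield_base_le V L) :=
      ⟨residue V ⟨x, hx⟩, residue_mem_residueSubfield_intermediateField V x hx⟩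
    have h1 : residue V ⟨(rep r : Ω), hrep_mem r⟩ = residue V ⟨x, hx⟩ := hrep_eq r
    rw [residue_mk_eq_iff] at h1
    change residue V ⟨(σ (rep r) : L), _⟩ = _
    rw [residue_mk_eq_iff]
    exact valuation_sub_lt_one_of_stable hV σ h1
  -- every element of `Lv` is a residue
  have hsurj : ∀ r : Subfield.extendScalars (residueSubfield_base_le V L),
      ∃ (x : L) (hx : (x : Ω) ∈ V),
        r = ⟨residue V ⟨x, hx⟩, residue_mem_residueSubfield_intermediateField V x hx⟩ :=
    fun r => ⟨rep r, hrep_mem r, Subtype.ext (hrep_eq r).symm⟩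
  refine ⟨{ toFun := f
            map_one' := ?_
            map_mul' := ?_
            map_zero' := ?_
            map_add' := ?_
            commutes' := ?_ }, hf⟩
  · have h1 : (1 : Subfield.extendScalars (residueSubfield_base_le V L)) =
        ⟨residue V ⟨((1 : L) : Ω), by push_cast; exact V.one_mem⟩,
          residue_mem_residueSubfield_intermediateField V 1 _⟩ :=
      Subtype.ext (by push_cast; exact (map_one (residue V)).symm)
    rw [h1, hf]
    have : (⟨((σ 1 : L) : Ω), (hV σ 1).mp (by push_cast; exact V.one_mem)⟩ : V) = 1 :=
      Subtype.ext (by push_cast [map_one]; rfl)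
    rw [this, map_one]
  · intro r s
    obtain ⟨x, hx, rfl⟩ := hsurj r
    obtain ⟨y, hy, rfl⟩ := hsurj s
    have hxy : ((x * y : L) : Ω) ∈ V := by push_cast; exact mul_mem hx hy
    have h1 : (⟨residue V ⟨x, hx⟩, residue_mem_residueSubfield_intermediateField V x hx⟩ *
          ⟨residue V ⟨y, hy⟩, residue_mem_residueSubfield_intermediateField V y hy⟩ :
          Subfield.extendScalars (residueSubfield_base_le V L)) =
        ⟨residue V ⟨((x * y : L) : Ω), hxy⟩,
          residue_mem_residueSubfield_intermediateField V (x * y) hxy⟩ := by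
      apply Subtype.ext
      change residue V ⟨x, hx⟩ * residue V ⟨y, hy⟩ = residue V ⟨((x * y : L) : Ω), hxy⟩
      rw [← map_mul]
      rfl
    rw [h1, hf, hf, hf, ← map_mul]
    exact congrArg (residue V) (Subtype.ext (by push_cast [map_mul]; rfl))
  · have h0 : (0 : Subfield.extendScalars (residueSubfield_base_le V L)) =
        ⟨residue V ⟨((0 : L) : Ω), by push_cast; exact V.zero_mem⟩,
          residue_mem_residueSubfield_intermediateField V 0 _⟩ :=
      Subtype.ext (by push_cast; exact (map_zero (residue V)).symm)
    rw [h0, hf]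
    have : (⟨((σ 0 : L) : Ω), (hV σ 0).mp (by push_cast; exact V.zero_mem)⟩ : V) = 0 :=
      Subtype.ext (by push_cast [map_zero]; rfl)
    rw [this, map_zero]
  · intro r s
    obtain ⟨x, hx, rfl⟩ := hsurj r
    obtain ⟨y, hy, rfl⟩ := hsurj s
    have hxy : ((x + y : L) : Ω) ∈ V := by push_cast; exact add_mem hx hy
    have h1 : (⟨residue V ⟨x, hx⟩, residue_mem_residueSubfield_intermediateField V x hx⟩ +
          ⟨residue V ⟨y, hy⟩, residue_mem_residueSubfield_intermediateField V y hy⟩ :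
          Subfield.extendScalars (residueSubfield_base_le V L)) =
        ⟨residue V ⟨((x + y : L) : Ω), hxy⟩,
          residue_mem_residueSubfield_intermediateField V (x + y) hxy⟩ := by
      apply Subtype.ext
      change residue V ⟨x, hx⟩ + residue V ⟨y, hy⟩ = residue V ⟨((x + y : L) : Ω), hxy⟩
      rw [← map_add]
      rfl
    rw [h1, hf, hf, hf, ← map_add]
    exact congrArg (residue V) (Subtype.ext (by push_cast [map_add]; rfl))
  · intro c
    obtain ⟨d, hd, hdc⟩ := (mem_residueSubfield_subfield_iff V (c : ResidueField V)).mp c.2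
    have hdL : ((algebraMap F L d : L) : Ω) ∈ V := hd
    have h1 : (algebraMap (residueSubfield F V)
        (Subfield.extendScalars (residueSubfield_base_le V L)) c) =
        ⟨residue V ⟨((algebraMap F L d : L) : Ω), hdL⟩,
          residue_mem_residueSubfield_intermediateField V _ hdL⟩ := by
      apply Subtype.ext
      change (c : ResidueField V) = residue V ⟨((algebraMap F L d : L) : Ω), hdL⟩
      rw [← hdc]
      rfl
    rw [h1, hf]
    change residue V ⟨((σ (algebraMap F L d) : L) : Ω), _⟩ = (c : ResidueField V)
    rw [← hdc]
    congr 1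
    apply Subtype.ext
    change ((σ (algebraMap F L d) : L) : Ω) = (d : Ω)
    rw [AlgEquiv.commutes]
    exact (IsScalarTower.algebraMap_apply F L Ω d).symm


/-! ### `[G : I]` is at most the separable degree of `Lv|Fv` -/

/-- **`[G : I] ≤ [(Lv)_s : Fv]`**: automorphisms in different cosets of the inertia group `I`
induce different `Fv`-algebra maps `Lv → Ωv`, and (`Ωv` being algebraically closed) the number
of such maps is the separable degree of `Lv|Fv`, i.e. the degree of the separable closure
`(Lv)_s` of `Fv` in `Lv`. [cite: Kuhlmann2010, Section 1.1] -/
theorem index_inertia_le_finrank_separableClosure [IsAlgClosed Ω]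
    (hV : ∀ (σ : L ≃ₐ[F] L) (x : L), (x : Ω) ∈ V ↔ ((σ x : L) : Ω) ∈ V)
    (I : Subgroup (L ≃ₐ[F] L))
    (hI : ∀ σ, σ ∈ I ↔
      ∀ x : L, (x : Ω) ∈ V → V.valuation (((σ x : L) : Ω) - x) < 1)
    [FiniteDimensional (residueSubfield F V)
      (Subfield.extendScalars (residueSubfield_base_le V L))] :
    I.index ≤ finrank (residueSubfield F V)
      (separableClosure (residueSubfield F V)
        (Subfield.extendScalars (residueSubfield_base_le V L))) := by
  classical
  choose ψ hψ using fun σ => exists_residueAlgHom hV σ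
  -- automorphisms with the same residue map lie in the same coset of `I`
  have hinj : ∀ a b : L ≃ₐ[F] L, ψ a = ψ b → a⁻¹ * b ∈ I := by
    intro a b hab
    rw [hI]
    intro x hx
    have hax : ((a x : L) : Ω) ∈ V := (hV a x).mp hx
    have hbx : ((b x : L) : Ω) ∈ V := (hV b x).mp hx
    have h1 : residue V ⟨(a x : L), hax⟩ = residue V ⟨(b x : L), hbx⟩ := by
      rw [← hψ a x hx, ← hψ b x hx, hab]
    rw [residue_mk_eq_iff] at h1
    have h2 := valuation_sub_lt_one_of_stable hV a⁻¹ h1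
    rw [show a⁻¹ (a x) = x from AlgEquiv.symm_apply_apply a x, ← AlgEquiv.mul_apply,
      ← Valuation.map_neg, neg_sub] at h2
    exact h2
  haveI : IsAlgClosed (ResidueField V) := isAlgClosed_residueField_of_isAlgClosed V
  haveI : Algebra.IsAlgebraic (residueSubfield F V)
      (Subfield.extendScalars (residueSubfield_base_le V L)) := Algebra.IsAlgebraic.of_finite _ _
  let Φ : (L ≃ₐ[F] L) ⧸ I → (Subfield.extendScalars (residueSubfield_base_le V L)
      →ₐ[residueSubfield F V] ResidueField V) := fun q => ψ q.out
  have hΦ : Function.Injective Φ := by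
    intro q₁ q₂ h
    rw [← QuotientGroup.out_eq' q₁, ← QuotientGroup.out_eq' q₂, QuotientGroup.eq]
    exact hinj _ _ h
  calc I.index = Nat.card ((L ≃ₐ[F] L) ⧸ I) := Subgroup.index_eq_card I
    _ ≤ Nat.card (Subfield.extendScalars (residueSubfield_base_le V L)
          →ₐ[residueSubfield F V] ResidueField V) := Nat.card_le_card_of_injective Φ hΦ
    _ = Field.finSepDegree (residueSubfield F V)
          (Subfield.extendScalars (residueSubfield_base_le V L)) :=
        (Field.finSepDegree_eq_of_isAlgClosed _ _ _).symm
    _ = finrank (residueSubfield F V) (separableClosure (residueSubfield F V)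
          (Subfield.extendScalars (residueSubfield_base_le V L))) := by
        rw [Field.finSepDegree_eq]
        rfl

end Literature.AlgebraicGeometry.Resolution
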